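import Literature.Algebra.EuclideanLattices.RegevUSVPNumerics
import Literature.Algebra.EuclideanLattices.RegevTwoPoint
import Literature.Algebra.EuclideanLattices.RegevPointSet
import Literature.Algebra.EuclideanLattices.RegevCoefficientBound
import Literature.Algebra.EuclideanLattices.RegevCandidateSelection
import Literature.Algebra.EuclideanLattices.LatticeProblemsProofs
import Literature.Algebra.EuclideanLattices.SuccessiveMinimaProofs
import Mathlib.Data.Real.Pointwise
import HarnessLib

/-!
# Regev's reduction `uSVP ≤ DCP`: the hypotheses of Claim 3.13 on a unique-SVP instance

Fifteenth file (XIV-b) of the construction discharging `usvp_of_dihedralCoset` (Regev 2004,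
Thm. 1.1). For a nonsingular, LLL-reduced integer basis `B` of dimension `n` whose shortest vector
is `c(f) n^{1/2+2f}`-unique (`c(f) = 2 c_A + 1`), at a dimension where the eventual inequalities of
file XIV-a hold, we construct the data of Regev's fibre hypotheses (`Regev2004.FiberHyp`, Claim
3.13) for the **scaled** instance `2ⁿ B` and check the numerical budget of Claim 3.14:

* `successiveMinimum_smul` — `λᵢ(c L) = c λᵢ(L)` (`c > 0`), and the scaled instance `I.zscale Λ`
  (`lattice_zscale`, `minNorm_zscale`, `successiveMinimum_zscale`, `ofCoeffs_zscale`);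
* `exists_shortest_odd` — a shortest vector of `L(B)` has a primitive coefficient vector, in
  particular one with an odd coordinate `u_{i₀}` (so that `m = u_{i₀} mod 2ᵉ` is coprime to the
  modulus `p = 2ᵉ` of file XIV-a);
* `InstData` — the chosen data (`u`, `i₀`, `m`, the radius index `ρ₀`) with its properties,
  `exists_instData`; `fiberHyp_instData` — **Claim 3.13's hypotheses hold**;
  `budget_instData` — **Claim 3.14's budget** `(∑|δᵢ|)/2^{4n} + 2ε ≤ η` and `0 < innerRad`.

## References

* O. Regev, *Quantum computation and lattice problems*, SIAM J. Comput. 33 (2004), Lemma 3.3,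
  proof of Lemma 3.12 (p. 14), Claims 3.13–3.14.
-/

noncomputable section

namespace Literature.Algebra.EuclideanLattices

open scoped Pointwise
open Module Metric

/-! ### Scaling a lattice -/

section Scaling

variable {E : Type*} [NormedAddCommGroup E] [NormedSpace ℝ E]

/-- **Successive minima of a scaled lattice**: `λᵢ(c L) = c λᵢ(L)` for `c > 0`. [cite: MicciancioGoldwasser2002, Ch. 1 §1] -/
theorem successiveMinimum_smul (L : Submodule ℤ E) {c : ℝ} (hc : 0 < c) (i : ℕ) :
    successiveMinimum (c • L) i = c * successiveMinimum L i := by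
  unfold successiveMinimum
  have key : ∀ r : ℝ, Submodule.span ℝ (((c • L : Submodule ℤ E) : Set E) ∩ closedBall (0 : E) r) =
      Submodule.span ℝ ((L : Set E) ∩ closedBall (0 : E) (r / c)) := by
    intro r
    have hset : ((c • L : Submodule ℤ E) : Set E) ∩ closedBall (0 : E) r = c • ((L : Set E) ∩ closedBall (0 : E) (r / c)) := by
      ext x
      rw [Submodule.coe_pointwise_smul, Set.mem_inter_iff, Set.mem_smul_set_iff_inv_smul_mem₀ hc.ne',
        Set.mem_smul_set_iff_inv_smul_mem₀ hc.ne', Set.mem_inter_iff, mem_closedBall_zero_iff, mem_closedBall_zero_iff, norm_smul,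
        norm_inv, Real.norm_eq_abs, abs_of_pos hc, inv_mul_le_iff₀ hc, show c * (r / c) = r by field_simp]
    rw [hset, Submodule.span_smul_eq_of_isUnit _ _ (isUnit_iff_ne_zero.2 hc.ne')]
  have hT : {r : ℝ | 0 ≤ r ∧ i ≤ finrank ℝ (Submodule.span ℝ (((c • L : Submodule ℤ E) : Set E) ∩ closedBall (0 : E) r))} =
      c • {r : ℝ | 0 ≤ r ∧ i ≤ finrank ℝ (Submodule.span ℝ ((L : Set E) ∩ closedBall (0 : E) r))} := by
    ext r
    rw [Set.mem_smul_set_iff_inv_smul_mem₀ hc.ne', Set.mem_setOf_eq, Set.mem_setOf_eq, key r, smul_eq_mul, inv_mul_eq_div]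
    constructor
    · rintro ⟨h0, h1⟩; exact ⟨div_nonneg h0 hc.le, h1⟩
    · rintro ⟨h0, h1⟩; exact ⟨by rwa [le_div_iff₀ hc, zero_mul] at h0, h1⟩
  rw [hT, Real.sInf_smul_of_nonneg hc.le, smul_eq_mul]

/-- **Minimum distance of a scaled lattice**: `λ₁(c L) = c λ₁(L)` for `c > 0` (the case of
`RegevDualQuery.minNorm_pointwise_smul`, reproved to keep the import closure small). [cite: MicciancioGoldwasser2002, Ch. 1 §1] -/
private theorem minNorm_smul_of_pos (L : Submodule ℤ E) {c : ℝ} (hc : 0 < c) : minNorm (c • L) = c * minNorm L := by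
  unfold minNorm
  have hset : {x : E | x ∈ c • L ∧ x ≠ 0} = c • {x : E | x ∈ L ∧ x ≠ 0} := by
    ext x
    rw [Set.mem_smul_set_iff_inv_smul_mem₀ hc.ne', Set.mem_setOf_eq, Set.mem_setOf_eq, Submodule.mem_smul_pointwise_iff_exists]
    constructor
    · rintro ⟨⟨y, hy, rfl⟩, h0⟩
      rw [smul_smul, inv_mul_cancel₀ hc.ne', one_smul]
      exact ⟨hy, fun hy0 => h0 (by rw [hy0, smul_zero])⟩
    · rintro ⟨hx, h0⟩
      exact ⟨⟨c⁻¹ • x, hx, by rw [smul_smul, mul_inv_cancel₀ hc.ne', one_smul]⟩, fun hx0 => h0 (by rw [hx0, smul_zero])⟩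
  have himg : (‖·‖) '' (c • {y : E | y ∈ L ∧ y ≠ 0}) = c • ((‖·‖) '' {y : E | y ∈ L ∧ y ≠ 0}) := by
    ext r
    simp only [Set.mem_image, Set.mem_smul_set, smul_eq_mul]
    constructor
    · rintro ⟨_, ⟨y, hy, rfl⟩, rfl⟩
      exact ⟨‖y‖, ⟨y, hy, rfl⟩, by rw [norm_smul, Real.norm_eq_abs, abs_of_pos hc]⟩
    · rintro ⟨_, ⟨y, hy, rfl⟩, rfl⟩
      exact ⟨c • y, ⟨y, hy, rfl⟩, by rw [norm_smul, Real.norm_eq_abs, abs_of_pos hc]⟩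
  rw [hset, himg, Real.sInf_smul_of_nonneg hc.le, smul_eq_mul]

end Scaling

namespace LatticeInstance

variable (I : LatticeInstance)

/-- **The scaled instance** `Λ B`, in the `Matrix`-scalar form `Λ • B` with an integer `Λ`
(cf. `LatticeInstance.scale` of `ScaledInstance.lean`, the entrywise form with a natural factor; the
files IX–XII of this construction handle `Λ • B` through `rowsOf`, `reidx` and `Matrix.vecMul_smul`,
whence this variant). [cite: Regev2004, Lemma 3.12 (proof, p. 14: w.l.o.g. the lattice is scaled)] -/
abbrev zscale (Λ : ℤ) : LatticeInstance := ⟨I.n, Λ • I.basis⟩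

/-- The rows of the scaled instance. [folklore] -/
theorem zscale_vec (Λ : ℤ) (i : Fin I.n) : (I.zscale Λ).vec i = (Λ : ℝ) • I.vec i := by
  change intVecToEuclidean I.n (Λ • I.basis i) = (Λ : ℝ) • intVecToEuclidean I.n (I.basis i)
  rw [map_zsmul, Int.cast_smul_eq_zsmul]

/-- Lattice vectors of the scaled instance. [folklore] -/
theorem ofCoeffs_zscale (Λ : ℤ) (z : Fin I.n → ℤ) : (I.zscale Λ).ofCoeffs z = (Λ : ℝ) • I.ofCoeffs z := by
  change intVecToEuclidean I.n (Matrix.vecMul z (Λ • I.basis)) = (Λ : ℝ) • intVecToEuclidean I.n (Matrix.vecMul z I.basis)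
  rw [Matrix.vecMul_smul, map_zsmul, Int.cast_smul_eq_zsmul]

/-- **The lattice of the scaled instance is the scaled lattice.** [folklore] -/
theorem lattice_zscale (Λ : ℤ) : (I.zscale Λ).lattice = (Λ : ℝ) • I.lattice := by
  change Submodule.span ℤ (Set.range (I.zscale Λ).vec) = (Λ : ℝ) • Submodule.span ℤ (Set.range I.vec)
  rw [Submodule.smul_span]
  congr 1
  ext x
  simp only [Set.mem_range]
  constructor
  · rintro ⟨i, rfl⟩; exact ⟨I.vec i, ⟨i, rfl⟩, (I.zscale_vec Λ i).symm⟩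
  · rintro ⟨_, ⟨i, rfl⟩, rfl⟩; exact ⟨i, I.zscale_vec Λ i⟩

/-- The scaled instance is nonsingular. [folklore] -/
theorem isNonsingular_zscale {Λ : ℤ} (hΛ : Λ ≠ 0) (hI : I.IsNonsingular) : (I.zscale Λ).IsNonsingular := by
  change (Λ • I.basis).det ≠ 0
  rw [Matrix.det_smul]
  exact mul_ne_zero (pow_ne_zero _ hΛ) hI

/-- `λ₁` of the scaled instance. [folklore] -/
theorem minNorm_zscale {Λ : ℤ} (hΛ : 0 < Λ) : minNorm (I.zscale Λ).lattice = (Λ : ℝ) * minNorm I.lattice := by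
  rw [lattice_zscale]; exact minNorm_smul_of_pos I.lattice (by exact_mod_cast hΛ)

/-- `λᵢ` of the scaled instance. [folklore] -/
theorem successiveMinimum_zscale {Λ : ℤ} (hΛ : 0 < Λ) (i : ℕ) :
    successiveMinimum (I.zscale Λ).lattice i = (Λ : ℝ) * successiveMinimum I.lattice i := by
  rw [lattice_zscale]; exact successiveMinimum_smul I.lattice (by exact_mod_cast hΛ) i

end LatticeInstance

namespace Regev2004

open LatticeInstance

/-! ### Integer lattices: `λ₁ ≥ 1` and a shortest vector with an odd coordinate -/

/-- A nonzero integer vector has norm at least `1`. [folklore] -/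
theorem one_le_norm_intVecToEuclidean {n : ℕ} {v : Fin n → ℤ} (hv : v ≠ 0) : 1 ≤ ‖intVecToEuclidean n v‖ := by
  obtain ⟨i, hi⟩ : ∃ i, v i ≠ 0 := Function.ne_iff.1 hv
  have h1 : (1 : ℝ) ≤ ((v i : ℝ)) ^ 2 := by
    have : (1 : ℤ) ≤ (v i) ^ 2 := by nlinarith [Int.one_le_abs hi, sq_abs (v i)]
    exact_mod_cast this
  rw [norm_intVecToEuclidean]
  refine Real.le_sqrt_of_sq_le ?_
  rw [one_pow]
  exact h1.trans (Finset.single_le_sum (f := fun j => ((v j : ℝ)) ^ 2) (fun j _ => sq_nonneg _) (Finset.mem_univ i))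

/-- `ofCoeffs` of the zero vector. [folklore] -/
theorem ofCoeffs_zero' (I : LatticeInstance) : I.ofCoeffs 0 = 0 := by
  rw [LatticeInstance.ofCoeffs_eq_sum]; simp

/-- For a nonsingular basis, `ofCoeffs u = 0` forces `u = 0`. [folklore] -/
theorem eq_zero_of_ofCoeffs_eq_zero {I : LatticeInstance} (hI : I.IsNonsingular) {u : Fin I.n → ℤ} (h : I.ofCoeffs u = 0) : u = 0 :=
  Matrix.eq_zero_of_vecMul_eq_zero hI (intVecToEuclidean_injective I.n (by rw [map_zero]; exact h))

/-- **A nonsingular integer lattice has `λ₁ ≥ 1`**: every nonzero lattice vector is a nonzero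
integer vector. [folklore] -/
theorem one_le_minNorm {I : LatticeInstance} (hI : I.IsNonsingular) (hn : 1 ≤ I.n) : 1 ≤ minNorm I.lattice := by
  have hb0 : I.vec ⟨0, hn⟩ ≠ 0 := (LatticeInstance.linearIndependent_vec hI).ne_zero _
  have hmem : I.vec ⟨0, hn⟩ ∈ I.lattice := Submodule.subset_span ⟨_, rfl⟩
  refine le_csInf ⟨_, ⟨_, ⟨hmem, hb0⟩, rfl⟩⟩ ?_
  rintro _ ⟨x, ⟨hxL, hx0⟩, rfl⟩
  obtain ⟨z, rfl⟩ := (I.mem_lattice_iff x).1 hxL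
  have hz : Matrix.vecMul z I.basis ≠ 0 := fun h0 => hx0 (by change intVecToEuclidean I.n (Matrix.vecMul z I.basis) = 0; rw [h0, map_zero])
  exact one_le_norm_intVecToEuclidean hz

/-- **A shortest vector has an odd coordinate.** The coefficient vector `u` of a shortest nonzero
vector of a nonsingular integer lattice is primitive: if every `uᵢ` were even, `ū/2` would be a
shorter nonzero lattice vector. [cite: Regev2004, Lemma 3.12 (proof, p. 14: u_{i₀} coprime to p)] -/
theorem exists_shortest_odd {I : LatticeInstance} (hI : I.IsNonsingular) (hn : 1 ≤ I.n) :
    ∃ u : Fin I.n → ℤ, ‖I.ofCoeffs u‖ = minNorm I.lattice ∧ u ≠ 0 ∧ ∃ i₀, Odd (u i₀) := by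
  have hb0 : I.vec ⟨0, hn⟩ ≠ 0 := (LatticeInstance.linearIndependent_vec hI).ne_zero _
  have hL : I.lattice ≠ ⊥ := fun h => hb0 (by
    have : I.vec ⟨0, hn⟩ ∈ I.lattice := Submodule.subset_span ⟨_, rfl⟩
    rw [h] at this; exact (Submodule.mem_bot ℤ).1 this)
  obtain ⟨v, hvL, hv0, hvmin⟩ := exists_mem_norm_eq_minNorm_holds I.lattice hL
  obtain ⟨u, rfl⟩ := (I.mem_lattice_iff v).1 hvL
  have hu0 : u ≠ 0 := by rintro rfl; exact hv0 (ofCoeffs_zero' I)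
  refine ⟨u, hvmin, hu0, ?_⟩
  by_contra hall
  have heven : ∀ i, Even (u i) := fun i => Int.not_odd_iff_even.1 (fun hi => hall ⟨i, hi⟩)
  choose w hw using heven
  have hu : u = 2 • w := funext fun i => by rw [hw i, Pi.smul_apply, two_nsmul]
  have hw0 : w ≠ 0 := by rintro rfl; apply hu0; rw [hu]; simp
  have hcoe : I.ofCoeffs u = (2 : ℝ) • I.ofCoeffs w := by
    change intVecToEuclidean I.n (Matrix.vecMul u I.basis) = (2 : ℝ) • intVecToEuclidean I.n (Matrix.vecMul w I.basis)
    rw [hu, Matrix.smul_vecMul, map_nsmul, two_nsmul, two_smul]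
  have hwL : I.ofCoeffs w ∈ I.lattice := I.ofCoeffs_mem_lattice w
  have hw0' : I.ofCoeffs w ≠ 0 := fun h => hw0 (eq_zero_of_ofCoeffs_eq_zero hI h)
  have hle : minNorm I.lattice ≤ ‖I.ofCoeffs w‖ := minNorm_le_norm_of_mem hwL hw0'
  rw [← hvmin, hcoe, norm_smul, Real.norm_eq_abs, abs_of_pos (by norm_num : (0 : ℝ) < 2)] at hle
  have hpos : 0 < ‖I.ofCoeffs w‖ := norm_pos_iff.2 hw0'
  linarith

/-! ### The data of the reduction on an instance -/

/-- The promise constant `c(f) = 2 c_A + 1`. [cite: Regev2004, Thm. 1.1 (the constant of Θ(n^{1/2+2f}))] -/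
def cOf (f : ℝ) : ℝ := 2 * cA f + 1

/-- The promise function `c(f) n^{1/2+2f}`. [cite: Regev2004, Thm. 1.1] -/
def gammaOf (f : ℝ) (n : ℕ) : ℝ := cOf f * (n : ℝ) ^ ((1 : ℝ) / 2 + 2 * f)

/-- The scaling factor `Λ = 2ⁿ`. [cite: Regev2004, Lemma 3.12 (proof, p. 14)] -/
def scaleOf (n : ℕ) : ℤ := 2 ^ n

/-- `0 < Λ`. [folklore] -/
theorem scaleOf_pos (n : ℕ) : 0 < scaleOf n := by unfold scaleOf; positivity

/-- The scaled instance `J = 2ⁿ B`. [folklore] -/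
abbrev Jof (I : LatticeInstance) : LatticeInstance := I.zscale (scaleOf I.n)

/-- The modulus `p` as an integer. [folklore] -/
def pZ (f : ℝ) (n : ℕ) : ℤ := pOf f n

/-- `λ₁` of the scaled lattice. [folklore] -/
def lamOf (I : LatticeInstance) : ℝ := minNorm (Jof I).lattice

/-- The radius index `ρ₀ = ⌊log₂ ⌊R²/Q⌋⌋` (the cell size is `Δ = 2^{ρ₀}`). [cite: Regev2004, Lemma 3.12 (proof, p. 14: the guess of λ₁ up to a factor 2)] -/
def rhoOf (f : ℝ) (I : LatticeInstance) : ℕ := Nat.log 2 ⌊radA f I.n (lamOf I) ^ 2 / (Qof f I.n : ℝ)⌋₊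

/-- The cell size `Δ = 2^{ρ₀}`. [folklore] -/
def ΔOf (f : ℝ) (I : LatticeInstance) : ℕ := 2 ^ rhoOf f I

/-- `0 < Δ`. [folklore] -/
theorem ΔOf_pos (f : ℝ) (I : LatticeInstance) : 0 < ΔOf f I := by unfold ΔOf; positivity

/-- The point set `X`. [cite: Regev2004, Lemma 3.12 (proof, p. 14: the grid points of the ball)] -/
def XOf (f : ℝ) (I : LatticeInstance) : Finset (Fin I.n → ℤ) := pointSet I.n (Qof f I.n) (ΔOf f I) (ΔOf_pos f I)

/-- **The data of the reduction on an instance**: the coefficient vector of a shortest vector and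
an odd coordinate of it. [cite: Regev2004, Lemma 3.12 (proof, p. 14) and Claim 3.13 (hypotheses)] -/
structure InstData (I : LatticeInstance) where
  /-- the coefficients of a shortest vector -/
  u : Fin I.n → ℤ
  /-- a coordinate where `u` is odd -/
  i0 : Fin I.n
  /-- `ū` is a shortest vector -/
  shortest : ‖I.ofCoeffs u‖ = minNorm I.lattice
  /-- `u ≠ 0` -/
  ne_zero : u ≠ 0
  /-- `u_{i₀}` is odd -/
  odd : Odd (u i0)

/-- The data exist. [folklore] -/
theorem exists_instData {I : LatticeInstance} (hI : I.IsNonsingular) (hn : 1 ≤ I.n) : Nonempty (InstData I) := by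
  obtain ⟨u, h1, h2, i₀, h3⟩ := exists_shortest_odd hI hn
  exact ⟨⟨u, i₀, h1, h2, h3⟩⟩

namespace InstData

variable {I : LatticeInstance} (D : InstData I) (f : ℝ)

/-- The residue `m = u_{i₀} mod p`. [cite: Regev2004, Lemma 3.12 (proof, p. 14: the value m)] -/
def m : ℤ := D.u D.i0 % pZ f I.n

/-- The hidden shift `δ`. [cite: Regev2004, Claim 3.13] -/
def δ : Fin I.n → ℤ := hiddenShift D.i0 (pZ f I.n) (D.m f) D.u

/-- The shortest vector of `J` as an integer vector. [folklore] -/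
def uv : Fin I.n → ℤ := Matrix.vecMul D.u (Jof I).basis

end InstData

section Facts

variable {I : LatticeInstance} {f : ℝ}

/-- `p` is a power of two: `p = 2ᵉ`. [folklore] -/
theorem pZ_eq (f : ℝ) (n : ℕ) : pZ f n = 2 ^ Nat.size (2 * cA f * n ^ (2 * kOf f + 1) + 2) := by unfold pZ pOf; push_cast; rfl

/-- `2 ≤ p`. [folklore] -/
theorem two_le_pZ (f : ℝ) (n : ℕ) : 2 ≤ pZ f n := by unfold pZ; exact_mod_cast two_le_pOf f n

/-- The residue is odd. [folklore] -/
theorem InstData.m_odd (D : InstData I) (f : ℝ) : Odd (D.m f) := by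
  have hp : Even (pZ f I.n) := by
    rw [pZ_eq]
    have hs : Nat.size (2 * cA f * I.n ^ (2 * kOf f + 1) + 2) ≠ 0 := by rw [Ne, Nat.size_eq_zero]; omega
    exact (Int.even_pow' hs).2 (by norm_num)
  have e : D.m f = D.u D.i0 - pZ f I.n * (D.u D.i0 / pZ f I.n) := by unfold InstData.m; rw [Int.emod_def]
  rw [e]
  exact D.odd.sub_even (hp.mul_right _)

/-- `0 < m`. [folklore] -/
theorem InstData.m_pos (D : InstData I) (f : ℝ) : 0 < D.m f := by
  have h0 : 0 ≤ D.m f := Int.emod_nonneg _ (by have := two_le_pZ f I.n; omega)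
  rcases h0.lt_or_eq with h | h
  · exact h
  · exfalso; have := D.m_odd f; rw [← h] at this; exact Int.not_odd_iff_even.2 (by decide) this

/-- `m < p`. [folklore] -/
theorem InstData.m_lt (D : InstData I) (f : ℝ) : D.m f < pZ f I.n := Int.emod_lt_of_pos _ (by have := two_le_pZ f I.n; omega)

/-- `m` is coprime to `p`. [folklore] -/
theorem InstData.coprime (D : InstData I) (f : ℝ) : IsCoprime (D.m f) (pZ f I.n) := by
  obtain ⟨k, hk⟩ := D.m_odd f
  have h2 : IsCoprime (D.m f) 2 := ⟨1, -k, by rw [hk]; ring⟩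
  rw [pZ_eq]; exact h2.pow_right

/-- `u_{i₀} ≡ m (mod p)`. [folklore] -/
theorem InstData.modEq (D : InstData I) (f : ℝ) : D.u D.i0 ≡ D.m f [ZMOD pZ f I.n] := (Int.mod_modEq _ _).symm

/-- `J` is nonsingular. [folklore] -/
theorem Jof_nonsing (hI : I.IsNonsingular) : (Jof I).IsNonsingular := I.isNonsingular_zscale (scaleOf_pos I.n).ne' hI

/-- `ū` (for `J`) is a shortest vector of `J`. [folklore] -/
theorem InstData.J_shortest (D : InstData I) : ‖(Jof I).ofCoeffs D.u‖ = minNorm (Jof I).lattice := by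
  change ‖(I.zscale (scaleOf I.n)).ofCoeffs D.u‖ = minNorm (I.zscale (scaleOf I.n)).lattice
  rw [I.ofCoeffs_zscale, norm_smul, I.minNorm_zscale (scaleOf_pos I.n), D.shortest, Real.norm_eq_abs,
    abs_of_pos (by exact_mod_cast scaleOf_pos I.n)]

/-- `λ₁(J) = 2ⁿ λ₁(L)`. [folklore] -/
theorem lamOf_eq (I : LatticeInstance) : lamOf I = (2 : ℝ) ^ I.n * minNorm I.lattice := by
  unfold lamOf Jof; rw [I.minNorm_zscale (scaleOf_pos I.n)]; unfold scaleOf; push_cast; ring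

/-- `λᵢ(J) = 2ⁿ λᵢ(L)`. [folklore] -/
theorem succMin_Jof (I : LatticeInstance) (i : ℕ) : successiveMinimum (Jof I).lattice i = (2 : ℝ) ^ I.n * successiveMinimum I.lattice i := by
  unfold Jof; rw [I.successiveMinimum_zscale (scaleOf_pos I.n)]; unfold scaleOf; push_cast; ring

/-- **`λ₁(J) ≥ 2ⁿ`.** [folklore] -/
theorem lamOf_ge (hI : I.IsNonsingular) (hn : 1 ≤ I.n) : (2 : ℝ) ^ I.n ≤ lamOf I := by
  rw [lamOf_eq]
  have := one_le_minNorm hI hn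
  have h2 : (0 : ℝ) ≤ (2 : ℝ) ^ I.n := by positivity
  nlinarith

/-- `‖ū‖ = λ₁(J)` for the integer vector `uv`. [folklore] -/
theorem InstData.norm_uv (D : InstData I) : ‖intVecToEuclidean I.n (D.uv)‖ = lamOf I := D.J_shortest

/-- **The window of the radius guess**: `R²/2 < Q Δ ≤ R²`. [folklore] -/
theorem window (hf : 0 < f) (h : NumOK f I.n) (hI : I.IsNonsingular) :
    radA f I.n (lamOf I) ^ 2 / 2 < (Qof f I.n : ℝ) * ΔOf f I ∧ (Qof f I.n : ℝ) * ΔOf f I ≤ radA f I.n (lamOf I) ^ 2 := by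
  have hn1 : 1 ≤ I.n := by have := h.four_le; omega
  have hlam := lamOf_ge hI hn1
  have hA : lamOf I ≤ radA f I.n (lamOf I) := le_radA hf hn1 (le_trans (by positivity) hlam)
  have hQ : (Qof f I.n : ℝ) ≤ radA f I.n (lamOf I) ^ 2 := by
    have e4 : (Qof f I.n : ℝ) ≤ (2 : ℝ) ^ I.n := by exact_mod_cast h.e4
    have h2 : (1 : ℝ) ≤ (2 : ℝ) ^ I.n := one_le_pow₀ (by norm_num)
    nlinarith
  have hQ0 : (0 : ℝ) < Qof f I.n := by
    have : 1 ≤ Qof f I.n := by have := two_mul_le_Qof f I.n; omega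
    have : (1 : ℝ) ≤ Qof f I.n := by exact_mod_cast this
    linarith
  have hw := window_log hQ0 hQ
  unfold ΔOf rhoOf
  push_cast
  exact hw

/-- Points of the point set are within `√(QΔ)` of the origin (any dimension `n ≥ 1`). [folklore] -/
theorem norm_le_of_mem_pointSet {n Q Δ : ℕ} (hΔ : 0 < Δ) (hn : 1 ≤ n) {x : Fin n → ℤ} (hx : x ∈ pointSet n Q Δ hΔ) :
    ‖intVecToEuclidean n x‖ ≤ Real.sqrt ((Q : ℝ) * Δ) := by
  obtain ⟨m, rfl⟩ : ∃ m, n = m + 1 := ⟨n - 1, by omega⟩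
  exact norm_le_of_mem_qBall hΔ (pointSet_subset_qBall _ _ _ hΔ hx)

/-- Differences of points of `X` are within `2R`. [folklore] -/
theorem norm_sub_le_two_radA (hf : 0 < f) (h : NumOK f I.n) (hI : I.IsNonsingular) {x x' : Fin I.n → ℤ} (hx : x ∈ XOf f I) (hx' : x' ∈ XOf f I) :
    ‖intVecToEuclidean I.n (x - x')‖ ≤ 2 * radA f I.n (lamOf I) := by
  have hn1 : 1 ≤ I.n := by have := h.four_le; omega
  obtain ⟨-, hShi, -⟩ := radius_window hf hn1 (lamOf_ge hI hn1) (window hf h hI).1 (window hf h hI).2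
  have h1 := norm_le_of_mem_pointSet (ΔOf_pos f I) hn1 hx
  have h2 := norm_le_of_mem_pointSet (ΔOf_pos f I) hn1 hx'
  rw [map_sub]
  refine (norm_sub_le _ _).trans ?_
  linarith

/-- **Claim 3.13's hypotheses hold on the scaled instance** with the chosen `i₀`, `p`, `m`, `u`
and point set, for a `c(f) n^{1/2+2f}`-unique shortest vector. [cite: Regev2004, Claim 3.13 (hypotheses, pp. 13–14) and Lemma 3.12 (proof, p. 14)] -/
theorem InstData.fiberHyp (D : InstData I) (hf : 0 < f) (h : NumOK f I.n) (hprom : USVP.Promise (gammaOf f) I) :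
    Regev2004.FiberHyp (Jof I) D.i0 (pZ f I.n) (D.m f) D.u (XOf f I) := by
  have hI : I.IsNonsingular := hprom.1
  have hn1 : 1 ≤ I.n := by have := h.four_le; omega
  have hlam := lamOf_ge hI hn1
  have hlam0 : 0 < lamOf I := lt_of_lt_of_le (by positivity) hlam
  have hne := one_le_rpow_half_add hf hn1
  refine ⟨Jof_nonsing hI, by have := h.four_le; change 2 ≤ I.n; omega, D.J_shortest, D.ne_zero, D.m_pos f, D.m_lt f, D.coprime f,
    D.modEq f, ?_, ?_⟩
  · -- `2R < λ₂(J)`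
    intro x hx x' hx'
    refine lt_of_le_of_lt (norm_sub_le_two_radA hf h hI hx hx') ?_
    have h2 := hprom.2
    change gammaOf f I.n * minNorm I.lattice ≤ successiveMinimum I.lattice 2 at h2
    rw [succMin_Jof]
    have e : 2 * radA f I.n (lamOf I) = (2 * cA f) * (I.n : ℝ) ^ ((1 : ℝ) / 2 + 2 * f) * lamOf I := by unfold radA; ring
    have e2 : (2 : ℝ) ^ I.n * (gammaOf f I.n * minNorm I.lattice) = cOf f * (I.n : ℝ) ^ ((1 : ℝ) / 2 + 2 * f) * lamOf I := by
      rw [lamOf_eq]; unfold gammaOf; ring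
    have h3 : (2 : ℝ) ^ I.n * (gammaOf f I.n * minNorm I.lattice) ≤ (2 : ℝ) ^ I.n * successiveMinimum I.lattice 2 :=
      mul_le_mul_of_nonneg_left h2 (by positivity)
    rw [e2] at h3
    have h4 : (2 * cA f) * (I.n : ℝ) ^ ((1 : ℝ) / 2 + 2 * f) * lamOf I < cOf f * (I.n : ℝ) ^ ((1 : ℝ) / 2 + 2 * f) * lamOf I := by
      unfold cOf
      have : 0 < (I.n : ℝ) ^ ((1 : ℝ) / 2 + 2 * f) * lamOf I := by positivity
      nlinarith
    rw [e]; linarith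
  · -- `2R < (p − 1) λ₁(J)`
    intro x hx x' hx'
    refine lt_of_le_of_lt (norm_sub_le_two_radA hf h hI hx hx') ?_
    rw [← lamOf, radA]
    have hp : (2 * cA f * (I.n : ℝ) ^ (2 * kOf f + 1) + 2 : ℝ) < (pZ f I.n : ℝ) := by
      have := lt_pOf f I.n; unfold pZ; exact_mod_cast this
    have hpow := rpow_half_add_le_pow f hn1
    have hcA : (0 : ℝ) ≤ cA f := Nat.cast_nonneg _
    have h5 : 2 * (cA f * (I.n : ℝ) ^ ((1 : ℝ) / 2 + 2 * f) * lamOf I) ≤ (2 * cA f * (I.n : ℝ) ^ (2 * kOf f + 1)) * lamOf I := by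
      have := mul_le_mul_of_nonneg_left hpow hcA
      nlinarith
    have h6 : (2 * cA f * (I.n : ℝ) ^ (2 * kOf f + 1)) * lamOf I < ((pZ f I.n : ℝ) - 1) * lamOf I := by
      apply mul_lt_mul_of_pos_right _ hlam0; linarith
    linarith

/-- **The hidden shift has small digits**: `∑ᵢ |δᵢ| ≤ ∑ᵢ |uᵢ| + |m|` (`δᵢ = uᵢ` for `i ≠ i₀`). [folklore] -/
theorem InstData.sum_natAbs_delta_le (D : InstData I) (f : ℝ) :
    (∑ i, ((D.δ f i).natAbs : ℝ)) ≤ (∑ i, ((D.u i).natAbs : ℝ)) + (D.m f).natAbs := by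
  have h0 : ((D.δ f D.i0).natAbs : ℝ) ≤ (D.u D.i0).natAbs + (D.m f).natAbs := by
    exact_mod_cast natAbs_hiddenShift_le D.i0 (pZ f I.n) (D.m f) D.u D.i0
  rw [← Finset.add_sum_erase _ _ (Finset.mem_univ D.i0), ← Finset.add_sum_erase _ (fun i => ((D.u i).natAbs : ℝ)) (Finset.mem_univ D.i0)]
  have h2 : ∑ i ∈ Finset.univ.erase D.i0, ((D.δ f i).natAbs : ℝ) = ∑ i ∈ Finset.univ.erase D.i0, ((D.u i).natAbs : ℝ) :=
    Finset.sum_congr rfl fun i hi => by unfold InstData.δ; rw [hiddenShift_of_ne (Finset.ne_of_mem_erase hi)]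
  rw [h2]
  linarith

/-- **`∑ᵢ |δᵢ| ≤ n 2^{2n} + p`** on an LLL-reduced basis (Lemma 3.3 for the coefficients of the
shortest vector). [cite: Regev2004, Lemma 3.3 and Claim 3.14 (the term n 2^{2n+1}/M)] -/
theorem InstData.sum_natAbs_delta_le' (D : InstData I) (f : ℝ) (hI : I.IsNonsingular) (hred : IsLLLReduced (3 / 4) I.vec) (hn : 1 ≤ I.n) :
    (∑ i, ((D.δ f i).natAbs : ℝ)) ≤ I.n * (2 : ℝ) ^ (2 * I.n) + pOf f I.n := by
  refine (D.sum_natAbs_delta_le f).trans ?_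
  have hu : ∀ i, ((D.u i).natAbs : ℝ) ≤ (2 : ℝ) ^ (2 * I.n) := fun i => by
    rw [Nat.cast_natAbs, Int.cast_abs]
    have := Regev2004.abs_coeff_le_of_norm_eq_minNorm hI hred hn D.shortest i
    exact_mod_cast this
  have hsum : (∑ i, ((D.u i).natAbs : ℝ)) ≤ I.n * (2 : ℝ) ^ (2 * I.n) := by
    calc (∑ i, ((D.u i).natAbs : ℝ)) ≤ ∑ _i : Fin I.n, (2 : ℝ) ^ (2 * I.n) := Finset.sum_le_sum fun i _ => hu i
      _ = I.n * (2 : ℝ) ^ (2 * I.n) := by simp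
  have hm : ((D.m f).natAbs : ℝ) ≤ pOf f I.n := by
    rw [Nat.cast_natAbs, Int.cast_abs, abs_of_pos (by exact_mod_cast D.m_pos f)]
    have := D.m_lt f; unfold pZ at this
    have h' : ((D.m f : ℤ) : ℝ) < ((pOf f I.n : ℕ) : ℤ) := by exact_mod_cast this
    push_cast at h'; linarith
  linarith

/-- **Claim 3.14's budget on the instance**: `5√n ≤ √(QΔ)` and `(∑|δᵢ|)/2^{4n} + 2 ε ≤ η`.
[cite: Regev2004, Claim 3.14 (p. 15)] -/
theorem InstData.budget (D : InstData I) (hf : 0 < f) (h : NumOK f I.n) (hI : I.IsNonsingular) (hred : IsLLLReduced (3 / 4) I.vec) :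
    5 * Real.sqrt I.n ≤ Real.sqrt ((Qof f I.n : ℝ) * ΔOf f I) ∧
      (∑ i, ((D.δ f i).natAbs : ℝ)) / (2 : ℝ) ^ (4 * I.n) +
        2 * shiftEps (I.n - 1) (Qof f I.n) (ΔOf f I) ‖intVecToEuclidean I.n D.uv‖ ≤ eta f I.n := by
  have hn1 : 1 ≤ I.n := by have := h.four_le; omega
  rw [D.norm_uv]
  exact Regev2004.budget hf h (lamOf_ge hI hn1) (window hf h hI).1 (window hf h hI).2 (D.sum_natAbs_delta_le' f hI hred hn1)

/-- **`0 < innerRad`** on the instance. [folklore] -/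
theorem innerRad_pos_inst (hf : 0 < f) (h : NumOK f I.n) (hI : I.IsNonsingular) : 0 < innerRad (I.n - 1) (Qof f I.n) (ΔOf f I) := by
  have hn1 : 1 ≤ I.n := by have := h.four_le; omega
  exact innerRad_pos_of_window hf h (lamOf_ge hI hn1) (window hf h hI).1 (window hf h hI).2

/-- `p ≤ 2ⁿ` (from `e3`). [folklore] -/
theorem pOf_le_two_pow (h : NumOK f I.n) : pOf f I.n ≤ 2 ^ I.n := by
  have := h.e3
  have h1 : 1 ≤ 4 * 5 ^ kOf f * I.n ^ (2 * kOf f) := by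
    have := Nat.one_le_pow (kOf f) 5 (by norm_num)
    have := Nat.one_le_pow (2 * kOf f) I.n (by have := h.four_le; omega)
    nlinarith
  nlinarith

/-- **The decoded digits fit**: `|uᵢ| + |m| < M = 2^{4n}`. [cite: Regev2004, Lemma 3.12 (proof, p. 14: ā ± δ stays in the box)] -/
theorem InstData.natAbs_add_lt (D : InstData I) (h : NumOK f I.n) (hI : I.IsNonsingular) (hred : IsLLLReduced (3 / 4) I.vec) (i : Fin I.n) :
    (D.u i).natAbs + (D.m f).natAbs < 2 ^ (4 * I.n) := by
  have hn1 : 1 ≤ I.n := by have := h.four_le; omega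
  have hu : (D.u i).natAbs ≤ 2 ^ (2 * I.n) := by
    have := Regev2004.abs_coeff_le_of_norm_eq_minNorm hI hred hn1 D.shortest i
    rw [Int.abs_eq_natAbs] at this
    exact_mod_cast this
  have hm : (D.m f).natAbs < 2 ^ I.n := by
    have h1 := D.m_lt f
    have h2 := D.m_pos f
    have hp := pOf_le_two_pow (I := I) h
    unfold pZ at h1
    have : ((D.m f).natAbs : ℤ) < ((2 ^ I.n : ℕ) : ℤ) := by
      rw [Int.natCast_natAbs, abs_of_pos h2]; exact lt_of_lt_of_le h1 (by exact_mod_cast hp)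
    exact_mod_cast this
  have h3 : 2 ^ (2 * I.n) + 2 ^ I.n < 2 ^ (4 * I.n) := by
    have e : 2 ^ (4 * I.n) = 2 ^ (2 * I.n) * 2 ^ (2 * I.n) := by rw [← pow_add]; ring_nf
    have h4 : 2 ^ I.n ≤ 2 ^ (2 * I.n) := Nat.pow_le_pow_right (by norm_num) (by omega)
    have h5 : 4 ≤ 2 ^ (2 * I.n) := by
      calc 4 = 2 ^ 2 := by norm_num
        _ ≤ 2 ^ (2 * I.n) := Nat.pow_le_pow_right (by norm_num) (by omega)
    rw [e]; nlinarith
  omega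

end Facts

end Regev2004

end Literature.Algebra.EuclideanLattices

end
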